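import Summits.MatrixMultiplication.MatrixMultiplication.Theorems.ObstructionDescentLevelTwoLine

set_option linter.dupNamespace false

/-!
# Every level of format 2 is `S₃`-symmetric; every level of every format is `S₃`-symmetric on `σ_N` (decomp-mm · lens 3 · gen 17)

Route `route-MatrixMultiplication-ObstructionDescent` (sub-problem `MatrixMultiplication`, `ω(ℂ) = 2`), rev 7 `3f9f51b758cc`;
support for the aside **`InvariantSaturation`** (item `stmt-MatrixMultiplication-32282`).  Continues the LANDED parts N
(`ObstructionDescentOddLevelFormatTwo`: the five-cell family `T(p,x,y,z)` and `evalT_family` at EVERY level `k`), AE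
(`ObstructionDescentLevelTwoSymmetry`: propagation of a slot character along the format tower, `evalT_permT_propagate_linear`)
and AF (`ObstructionDescentLevelTwoLine`: the level-2 case); restates nothing.

* **§1 Format 2, every level (`rename_slotPerm_eq_self_format_two`).**  For every `k` and every `σ ∈ S₃`, every weight vector
  `g ∈ R_k(2) = hwvSpace (rectType 2 2 k) (2k)` satisfies `g^σ = g`.  Proof exactly as AF's level-2 case, with part N's
  all-level family formula: `g(T(p,x,y,z)) = Σ_β c_β p^{k−2β}(xyz)^β` is symmetric in `x, y, z`, the transpositions `(0 1)`,
  `(1 2)` permute `x, y, z` on the family, a vector of `R_k(2)` vanishing on the family is zero, and `(0 1)`, `(1 2)` generate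
  `S₃`.  Classically: `ℂ[ℂ²⊗ℂ²⊗ℂ²]^{SL₂³} = ℂ[Δ]` with Cayley's `Δ` symmetric — obtained here without computing `Δ` or the ring.
* **§2 Every level, every format, on `σ_N` (`evalT_permT_symm_of_rank_le_format`).**  AE's propagation schedule
  `(k−1)(n+1+c) < k(n+3)` from the base format `2` admits `c = 2` at EVERY level `k ≥ 1` (and `c = 4` only at `k = 2`, AF's
  `σ_{N+2}`; `c = 3` at `k = 3`).  Hence for every `k ≥ 1`, `N ≥ 2`, `f ∈ R_k(N)`, `σ ∈ S₃` and every tensor `t` of rank `≤ N`: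
  `f(σ·t) = f(t)`; corner form at every ambient format `m ≥ N` (`evalT_permT_symm_corner`); polynomial form `f^σ − f ∈ I(σ_N)`.
SCOPE (honest): for odd `k` both sides vanish on `σ_N` by the landed pair law, so the content sits at even `k ≥ 4` and rank
exactly `N` (at `k = 2` AF is stronger); it is the statement that the restriction of a level to `σ_N = closure(GL_N³·⟨N⟩)` —
governed by the value at the `S₃`-fixed point `⟨N⟩` — carries the trivial slot character.  No new census input; nothing here
proves `ω = 2`.
[cite: BurgisserIkenmeyer2011, §3.1–3.2; BurgisserIkenmeyer2017, §5 (5.2), Thm 5.3; GelfandKapranovZelevinsky1994, Ch. 14 §1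
(Cayley's hyperdeterminant and its symmetry); LandsbergGCT2017, §2.1 (permutation of tensor factors)]
-/

noncomputable section

open scoped BigOperators
open Finset

namespace Summit.MatrixMultiplication.MatrixMultiplication.Theorems.ObstructionCalculus

open Literature.Computability.AlgebraicComplexity (tensorRank)

section FormatTwoSymmetry

variable {m k : ℕ}

/-! ### §1 · Every slot permutation fixes every vector of every level at format 2 -/

/-- A slot permutation mapping the five-cell family into itself up to a permutation of `x, y, z` fixes every `g ∈ R_k(2)`, at
every level `k` (AF's `rename_slotPerm_eq_self_of_family` with part N's all-level family formula). [this node] -/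
theorem rename_slotPerm_eq_self_of_family_level (σ : Equiv.Perm (Fin 3))
    (hσ : ∀ p x y z : ℂ, ∃ x' y' z' : ℂ, x' * y' * z' = x * y * z ∧
      permT σ (fun a b c => ![![![p, z], ![y, 0]], ![![x, 0], ![0, 1]]] a b c : Tensor ℂ 2) =
        fun a b c => ![![![p, z'], ![y', 0]], ![![x', 0], ![0, 1]]] a b c)
    {g : MvPolynomial (Idx 2) ℂ} (hg : g ∈ hwvSpace (rectType 2 2 k) (k * 2)) :
    MvPolynomial.rename (slotPerm σ) g = g := by
  rw [← sub_eq_zero]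
  refine eq_zero_of_family_eval_eq_zero (k := k) (Submodule.sub_mem _ (rename_slotPerm_mem_level hg σ) hg) ?_
  intro p x y z
  obtain ⟨x', y', z', hprod, hperm⟩ := hσ p x y z
  rw [map_sub, evalT_rename_slotPerm, hperm, evalT_family hg, evalT_family hg, hprod, sub_self]

/-- `(0 1)` and `(1 2)` fix every `g ∈ R_k(2)`, at every level `k`. [this node] -/
theorem rename_swap_eq_self_format_two {g : MvPolynomial (Idx 2) ℂ} (hg : g ∈ hwvSpace (rectType 2 2 k) (k * 2)) :
    MvPolynomial.rename (slotPerm (Equiv.swap 0 1)) g = g ∧ MvPolynomial.rename (slotPerm (Equiv.swap 1 2)) g = g :=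
  ⟨rename_slotPerm_eq_self_of_family_level _ (fun p x y z => ⟨y, x, z, by ring, permT_swap_zero_one_family p x y z⟩) hg,
    rename_slotPerm_eq_self_of_family_level _ (fun p x y z => ⟨x, z, y, by ring, permT_swap_one_two_family p x y z⟩) hg⟩

/-- **EVERY SLOT PERMUTATION FIXES EVERY VECTOR OF EVERY LEVEL AT FORMAT 2:** `g^σ = g` for all `σ ∈ S₃`, all `k`, all
`g ∈ R_k(2)` (classically `⊕_k R_k(2) = ℂ[Δ]` with `Δ` symmetric; proved here without computing `Δ`). [this node] -/
theorem rename_slotPerm_eq_self_format_two (σ : Equiv.Perm (Fin 3)) {g : MvPolynomial (Idx 2) ℂ}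
    (hg : g ∈ hwvSpace (rectType 2 2 k) (k * 2)) : MvPolynomial.rename (slotPerm σ) g = g := by
  obtain ⟨h01, h12⟩ := rename_swap_eq_self_format_two hg
  have gen : ∀ σ τ : Equiv.Perm (Fin 3), MvPolynomial.rename (slotPerm σ) g = g →
      MvPolynomial.rename (slotPerm τ) g = g → MvPolynomial.rename (slotPerm (τ * σ)) g = g := by
    intro σ τ hσ hτ
    have h := slotChar_mul (a := 1) (b := 1) (by rw [one_smul]; exact hσ) (by rw [one_smul]; exact hτ)
    rwa [one_mul, one_smul] at h
  rcases perm_fin_three_cases σ with rfl | rfl | rfl | rfl | rfl | rfl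
  · exact rename_slotPerm_one g
  · exact h01
  · exact h12
  · exact gen _ _ h12 h01
  · exact gen _ _ h01 h12
  · exact gen _ _ h01 (gen _ _ h12 h01)

/-- Evaluation form at format 2: `g(σ·t) = g(t)` for every `g ∈ R_k(2)` and every tensor `t ∈ ℂ²⊗ℂ²⊗ℂ²`. [this node] -/
theorem evalT_permT_eq_format_two (σ : Equiv.Perm (Fin 3)) {g : MvPolynomial (Idx 2) ℂ}
    (hg : g ∈ hwvSpace (rectType 2 2 k) (k * 2)) (t : Tensor ℂ 2) : evalT (permT σ t) g = evalT t g := by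
  rw [← evalT_rename_slotPerm, rename_slotPerm_eq_self_format_two σ hg]

/-! ### §2 · Every level of every format is `S₃`-symmetric on `σ_N` -/

/-- AE's propagation schedule from the base format `2` admits the slope `c = 2` at every level `k ≥ 1`:
`(k−1)(n+3) < k(n+3)`. [bookkeeping] -/
theorem propagate_schedule_two (hk : 1 ≤ k) (n : ℕ) : (k - 1) * (n + 1 + 2) < k * (2 + n + 1) := by
  obtain ⟨k', rfl⟩ : ∃ k', k = k' + 1 := ⟨k - 1, by omega⟩
  rw [Nat.add_sub_cancel]
  have h : (k' + 1) * (2 + n + 1) = k' * (n + 1 + 2) + (n + 3) := by ring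
  rw [h]
  omega

/-- Level `k ≥ 1` from format `2`: every `f ∈ R_k(2 + n)` satisfies `f(σ·t) = f(t)` for `R(t) ≤ n + 2`. [this node] -/
theorem evalT_permT_symm_of_two (σ : Equiv.Perm (Fin 3)) (hk : 1 ≤ k) (n : ℕ) {f : MvPolynomial (Idx (2 + n)) ℂ}
    (hf : f ∈ hwvSpace (rectType (2 + n) (2 + n) k) (k * (2 + n))) {t : Tensor ℂ (2 + n)}
    (ht : tensorRank t ≤ n + 2) : evalT (permT σ t) f = evalT t f := by
  have h := evalT_permT_propagate_linear (c := 2) (propagate_schedule_two hk) σ (χ := 1)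
    (fun g hg => by rw [one_smul]; exact rename_slotPerm_eq_self_format_two σ hg) n hf ht
  rwa [one_mul] at h

/-- **`S₃`-SYMMETRY OF EVERY LEVEL ON `σ_N` (unconditional).**  For every level `k ≥ 1`, every format `N ≥ 2`, every
`f ∈ R_k(N)`, every `σ ∈ S₃` and every tensor `t` of rank `≤ N`: `f(σ·t) = f(t)`. [this node] -/
theorem evalT_permT_symm_of_rank_le_format (σ : Equiv.Perm (Fin 3)) (hk : 1 ≤ k) {N : ℕ} (hN : 2 ≤ N)
    {f : MvPolynomial (Idx N) ℂ} (hf : f ∈ hwvSpace (rectType N N k) (k * N)) {t : Tensor ℂ N}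
    (ht : tensorRank t ≤ N) : evalT (permT σ t) f = evalT t f := by
  obtain ⟨n, rfl⟩ : ∃ n, N = 2 + n := ⟨N - 2, by omega⟩
  exact evalT_permT_symm_of_two σ hk n hf (by omega)

/-- Corner form at every ambient format `m ≥ N ≥ 2`: a weight vector of type `rectType m N k` is `S₃`-symmetric on the tensors
of rank `≤ N`. [this node] -/
theorem evalT_permT_symm_corner (σ : Equiv.Perm (Fin 3)) (hk : 1 ≤ k) {N : ℕ} (hN : 2 ≤ N) (hNm : N ≤ m)
    {F : MvPolynomial (Idx m) ℂ} (hF : F ∈ hwvSpace (rectType m N k) (k * N)) {s : Tensor ℂ m}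
    (hs : tensorRank s ≤ N) : evalT (permT σ s) F = evalT s F := by
  have h := lowRankChar_corner hNm σ (χ := 1)
    (fun _ hf _ ht => by rw [one_mul]; exact evalT_permT_symm_of_rank_le_format σ hk hN hf ht) F hF s hs
  rwa [one_mul] at h

/-- Polynomial form: `f^σ − f` vanishes on `σ_N` for every `f ∈ R_k(N)`, `k ≥ 1`, `N ≥ 2`. [this node] -/
theorem evalT_rename_sub_self_eq_zero_of_rank_le_format (σ : Equiv.Perm (Fin 3)) (hk : 1 ≤ k) {N : ℕ} (hN : 2 ≤ N)
    {f : MvPolynomial (Idx N) ℂ} (hf : f ∈ hwvSpace (rectType N N k) (k * N)) {t : Tensor ℂ N}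
    (ht : tensorRank t ≤ N) : evalT t (MvPolynomial.rename (slotPerm σ) f - f) = 0 := by
  rw [map_sub, evalT_rename_slotPerm, evalT_permT_symm_of_rank_le_format σ hk hN hf ht, sub_self]

/-- A weight vector of format `N ≥ 2`, level `k ≥ 1`, carrying a NON-TRIVIAL slot character `χ ≠ 1` for some `σ` dies on `σ_N`
(compare AE's level-2 clash law on `σ_{N+2}`). [this node] -/
theorem evalT_eq_zero_of_slotChar_ne_one (σ : Equiv.Perm (Fin 3)) (hk : 1 ≤ k) {N : ℕ} (hN : 2 ≤ N) {χ : ℂ} (hχ : χ ≠ 1)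
    {f : MvPolynomial (Idx N) ℂ} (hf : f ∈ hwvSpace (rectType N N k) (k * N))
    (hfχ : MvPolynomial.rename (slotPerm σ) f = χ • f) {t : Tensor ℂ N} (ht : tensorRank t ≤ N) :
    evalT t f = 0 := by
  have h := evalT_permT_symm_of_rank_le_format σ hk hN hf ht
  rw [evalT_permT_of_slotChar σ hfχ] at h
  have h' : (χ - 1) * evalT t f = 0 := by rw [sub_mul, h, one_mul, sub_self]
  exact (mul_eq_zero.mp h').resolve_left (sub_ne_zero.mpr hχ)

end FormatTwoSymmetry

end Summit.MatrixMultiplication.MatrixMultiplication.Theorems.ObstructionCalculus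

end
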